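import Summits.CriticalPhenomena.CardyFormulaZ2.Theses.CardySelfDualSegment
import Summits.CriticalPhenomena.CardyFormulaZ2.Theorems.CardySelfDualSegmentContinuitySweep
import Summits.CriticalPhenomena.CardyFormulaZ2.Theorems.CardySelfDualSegmentSegmentClosed
import Summits.CriticalPhenomena.CardyFormulaZ2.Theorems.CardySelfDualSegmentSmirnovBasePoint
import HarnessLib

/-!
# `SegmentOpen` is the route's `Target` modulo the two sibling cruxes (census, analyticity-free)

Route `CardySelfDualSegment` of `CriticalPhenomena/CardyFormulaZ2`, crux `SegmentOpen`
(stmt-CriticalPhenomena-5471): `UniformMarginality → IsOpen G`,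
`G = {t ∈ [0,1] | ∃ α, 0 < Im α ∧ CardyMod t α}`.

With `SegmentClosed` (stmt-5473, `segmentClosed_proof`), `SmirnovBasePoint` (stmt-5474,
`smirnovBasePoint_proof`) and `ContinuitySweep` (stmt-14382, `continuitySweep_proof`) PROVED in the
tree, the crux carries the whole remaining content of the route:

* `segmentOpen_of_target : Target → SegmentOpen` (unconditional: `G = univ` is open);
* `target_of_segmentOpen : UniformBoxCrossing → UniformMarginality → SegmentOpen → Target`
  (the continuity sweep with its two proved inputs discharged);
* `segmentOpen_iff_target : UniformBoxCrossing → UniformMarginality → (SegmentOpen ↔ Target)`;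
* `segmentOpen_iff_uniformMarginality_imp_target :
    UniformBoxCrossing → (SegmentOpen ↔ (UniformMarginality → Target))`;
* `not_segmentOpen_iff : UniformBoxCrossing → (¬ SegmentOpen ↔ (UniformMarginality ∧ ¬ Target))`.

So, modulo the route's a-priori crux `UniformBoxCrossing` (stmt-5476), `SegmentOpen` is LITERALLY
"uniform marginality implies linear universality on the whole segment", with no analyticity
hypothesis (contrast the S4-conditional census `stub_segmentOpen_iff_noIsolatedGoodPoint`,
`target_iff_smirnovGerm`): no line for this crux can be easier than the Target given the two sibling
cruxes, and a refutation of the crux is exactly uniform marginality together with a failure of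
linear universality at some parameter. This is the kernel-checked form of the strategist census D4
(`Cruxes/SegmentOpen/STRATEGY-CENSUS.md`) used by lead c7 to park the item behind
stmt-CriticalPhenomena-5472 / 5476.

References: S. Smirnov, C. R. Acad. Sci. Paris 333 (2001) (base point); V. Beffara, *Is critical 2D
percolation universal?*, Progr. Probab. 60 (2008), §2 (moving modulus); R. Langlands, P. Pouliot,
Y. Saint-Aubin, Bull. AMS 30 (1994) (linear universality).
-/

namespace Summit.CriticalPhenomena.CardyFormulaZ2.Theorems

open Summit.CriticalPhenomena.CardyFormulaZ2.Theses.CardySelfDualSegment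

/-- **`Target → SegmentOpen`** (unconditional): if every `t ∈ [0,1]` is good then the good set is
all of `[0,1]`, which is open; the marginality hypothesis of the crux is not used. [folklore] -/
theorem segmentOpen_of_target (hT : Target) : SegmentOpen := by
  intro _
  convert isOpen_univ
  exact Set.eq_univ_of_forall fun t => hT t

/-- **`SegmentOpen → Target` under the two sibling cruxes**: the continuity sweep
`continuitySweep_proof` (stmt-14382) with its inputs `SmirnovBasePoint` (`smirnovBasePoint_proof`,
stmt-5474) and `SegmentClosed` (`segmentClosed_proof`, stmt-5473) discharged by their tree proofs;
`UniformBoxCrossing` (stmt-5476) and `UniformMarginality` (stmt-5472) remain hypotheses (route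
decls, not claimed). [folklore] -/
theorem target_of_segmentOpen (hX : UniformBoxCrossing) (hM : UniformMarginality)
    (hO : SegmentOpen) : Target :=
  continuitySweep_proof smirnovBasePoint_proof hO segmentClosed_proof hM hX

/-- **Census: under `UniformBoxCrossing` and `UniformMarginality`, `SegmentOpen ↔ Target`.**
Both hypotheses are route decls (stmt-5476, stmt-5472), taken as hypotheses and not claimed. [folklore] -/
theorem segmentOpen_iff_target (hX : UniformBoxCrossing) (hM : UniformMarginality) :
    SegmentOpen ↔ Target :=
  ⟨target_of_segmentOpen hX hM, segmentOpen_of_target⟩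

/-- **Census: under `UniformBoxCrossing` alone, `SegmentOpen ↔ (UniformMarginality → Target)`** —
the crux is, verbatim up to the proved route items, "uniform marginality implies linear
universality along the whole self-dual segment". `UniformBoxCrossing` (stmt-5476) is a hypothesis,
not claimed. [folklore] -/
theorem segmentOpen_iff_uniformMarginality_imp_target :
    UniformBoxCrossing → (SegmentOpen ↔ (UniformMarginality → Target)) := fun hX =>
  ⟨fun hO hM => target_of_segmentOpen hX hM hO, fun h hM => segmentOpen_of_target (h hM) hM⟩

/-- **What a refutation of the crux would be** (under `UniformBoxCrossing`, hypothesis): `¬ SegmentOpen`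
holds iff uniform marginality holds AND linear universality fails at some parameter of the segment.
[folklore] -/
theorem not_segmentOpen_iff (hX : UniformBoxCrossing) :
    ¬ SegmentOpen ↔ (UniformMarginality ∧ ¬ Target) := by
  rw [segmentOpen_iff_uniformMarginality_imp_target hX, Classical.not_imp]

end Summit.CriticalPhenomena.CardyFormulaZ2.Theorems
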